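import Mathlib.Analysis.Calculus.ImplicitFunction.ProdDomain
import Mathlib.Analysis.Calculus.ContDiff.RCLike
import Mathlib.Analysis.Calculus.ContDiff.Basic
import Mathlib.Analysis.Calculus.ContDiff.Comp
import Mathlib.Analysis.Calculus.ContDiff.Operations
import Mathlib.Analysis.Calculus.FDeriv.Prod
import Mathlib.Topology.MetricSpace.Contracting
import Mathlib.Topology.Algebra.Module.FiniteDimension
import Mathlib.Analysis.Complex.Basic
import HarnessLib

/-!
# Implicit functions under a small Lipschitz perturbation (IFT + contraction)

Zilber's Exponential-Algebraic Closedness, case ladder (host summit Schanuel, cell `pub-schanuel`,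
seat 2, gen 15).  The existence theorems of gens 13–15 solve a rescaled ENTIRE system
`f(p, v) = 0` by the implicit function theorem at `(p, v) = (0, 0)`.  In the planned
double-cancelling regime (HANDOFF O59 PLAN) the true equation is `f(p, v) + Δ(v) = 0` where the
perturbation `Δ` (built from the super-exponentially small `e^{xⱼ}`) is NOT a smooth function of any
small parameter — it is merely tiny, with a tiny Lipschitz constant, on a ball around the clean
solution.  This file supplies the abstract persistence step:

* **`exists_zero_of_perturbed_implicit`** — `f : P × ℂ → ℂ` of class `C¹`, `f(0,0) = 0`,
  `∂ᵥf(0,0)` injective.  Then there are the clean solution `V(p)` (`f(p, V p) = 0`, `V p → 0`) and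
  constants `C, r > 0` such that for all `p` near `0`, every `ρ ∈ (0, r]` and every `Δ` with
  `‖Δ‖ ≤ ρ` and `Lip Δ ≤ 1/(2C)` on the closed ball `B(V p, Cρ)`, the perturbed equation
  `f(p, v) + Δ(v) = 0` has a solution in that ball.  Proof: the implicit function `W(p, d)` of
  `f(p, v) = d` is Lipschitz near `0` (`hasStrictFDerivAt_implicitFunctionOfProdDomain`,
  `HasStrictFDerivAt.exists_lipschitzOnWith`); `d ↦ −Δ(W(p, d))` is a `1/2`-contraction of the
  closed ball `|d| ≤ ρ` (`ContractingWith.exists_fixedPoint'`); its fixed point `d*` gives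
  `v = W(p, d*)`.

HONEST FRAMING: an abstract analytic lemma serving explicit families inside the OPEN cell
`EC(3,2)`; NOT Schanuel's conjecture; EAC ⇏ SC.
-/

noncomputable section

open Filter Topology Metric Set

set_option linter.dupNamespace false

namespace Summit.Schanuel.Schanuel.Theorems

section Perturbed

/-- **IFT under a small Lipschitz perturbation.**  See the module docstring. (new) -/
theorem exists_zero_of_perturbed_implicit {P : Type*} [NormedAddCommGroup P] [NormedSpace ℂ P]
    [CompleteSpace P] {f : P × ℂ → ℂ} (hf : ContDiff ℂ 1 f) (h0 : f (0, 0) = 0)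
    {L : ℂ →L[ℂ] ℂ} (hL : HasFDerivAt (fun v => f (0, v)) L 0) (hinj : Function.Injective L) :
    ∃ (V : P → ℂ) (C r : ℝ), 0 < C ∧ 0 < r ∧ Tendsto V (𝓝 0) (𝓝 0) ∧
      (∀ᶠ p in 𝓝 (0 : P), f (p, V p) = 0) ∧
      ∀ᶠ p in 𝓝 (0 : P), ∀ ρ : ℝ, 0 < ρ → ρ ≤ r → ∀ Δ : ℂ → ℂ,
        (∀ v ∈ closedBall (V p) (C * ρ), ‖Δ v‖ ≤ ρ) →
        (∀ v ∈ closedBall (V p) (C * ρ), ∀ v' ∈ closedBall (V p) (C * ρ),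
            ‖Δ v - Δ v'‖ ≤ (1 / (2 * C)) * ‖v - v'‖) →
        ∃ v ∈ closedBall (V p) (C * ρ), f (p, v) + Δ v = 0 := by
  -- the extended system `F((p, d), v) = f(p, v) - d`
  set F : (P × ℂ) × ℂ → ℂ := fun q => f (q.1.1, q.2) - q.1.2 with hF
  have hFC : ContDiff ℂ 1 F := by
    rw [hF]
    exact (ContDiff.comp hf ((contDiff_fst.comp contDiff_fst).prodMk contDiff_snd)).sub
      (contDiff_snd.comp contDiff_fst)
  set u : (P × ℂ) × ℂ := ((0, 0), 0) with hu
  have hFu : F u = 0 := by simp [hF, hu, h0]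
  have hstrict : HasStrictFDerivAt F (fderiv ℂ F u) u :=
    hFC.contDiffAt.hasStrictFDerivAt one_ne_zero
  -- the partial derivative in `v` is `L`, hence invertible
  have hpart : HasFDerivAt (fun v : ℂ => F (((0 : P), (0 : ℂ)), v))
      ((fderiv ℂ F u).comp (ContinuousLinearMap.inr ℂ (P × ℂ) ℂ)) 0 :=
    hstrict.hasFDerivAt.comp (0 : ℂ) (hasFDerivAt_prodMk_right (𝕜 := ℂ) ((0 : P), (0 : ℂ)) (0 : ℂ))
  have hpart' : HasFDerivAt (fun v : ℂ => F (((0 : P), (0 : ℂ)), v)) L 0 := by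
    have : (fun v : ℂ => F (((0 : P), (0 : ℂ)), v)) = fun v => f (0, v) := by
      funext v; simp [hF]
    rw [this]; exact hL
  have hLeq := hpart.unique hpart'
  have hinv : ((fderiv ℂ F u).comp (ContinuousLinearMap.inr ℂ (P × ℂ) ℂ)).IsInvertible := by
    rw [hLeq]
    have hsurj : Function.Surjective (L : ℂ →ₗ[ℂ] ℂ) :=
      LinearMap.injective_iff_surjective.1 hinj
    let e : ℂ ≃ₗ[ℂ] ℂ := LinearEquiv.ofBijective (L : ℂ →ₗ[ℂ] ℂ) ⟨hinj, hsurj⟩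
    exact ⟨e.toContinuousLinearEquiv, ContinuousLinearMap.ext fun w => rfl⟩
  -- the implicit function `W(p, d)` and its local Lipschitz constant
  set W : P × ℂ → ℂ := hstrict.implicitFunctionOfProdDomain hinv with hW
  have hWsol : ∀ᶠ x in 𝓝 ((0 : P), (0 : ℂ)), F (x, W x) = 0 := by
    have h := hstrict.eventually_apply_implicitFunctionOfProdDomain hinv
    rw [hFu] at h
    exact h
  have hWlim : Tendsto W (𝓝 ((0 : P), (0 : ℂ))) (𝓝 0) :=
    hstrict.tendsto_implicitFunctionOfProdDomain hinv
  obtain ⟨K, s, hs, hWlip⟩ :=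
    (hstrict.hasStrictFDerivAt_implicitFunctionOfProdDomain hinv).exists_lipschitzOnWith
  -- a ball inside both good sets
  obtain ⟨ε, hε, hball⟩ := Metric.mem_nhds_iff.1 (Filter.inter_mem hs hWsol)
  set C : ℝ := (K : ℝ) + 1 with hC
  have hCpos : 0 < C := by rw [hC]; positivity
  have hKC : (K : ℝ) ≤ C := by rw [hC]; linarith
  refine ⟨fun p => W (p, 0), C, ε / 2, hCpos, by linarith, ?_, ?_, ?_⟩
  · -- `V p → 0`
    have hc : Continuous fun p : P => (p, (0 : ℂ)) := by fun_prop
    have h1 : Tendsto (fun p : P => (p, (0 : ℂ))) (𝓝 0) (𝓝 ((0 : P), (0 : ℂ))) := by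
      simpa using hc.tendsto 0
    exact hWlim.comp h1
  · -- clean solutions
    have h1 : Tendsto (fun p : P => (p, (0 : ℂ))) (𝓝 0) (𝓝 ((0 : P), (0 : ℂ))) := by
      have hc : Continuous fun p : P => (p, (0 : ℂ)) := by fun_prop
      simpa using hc.tendsto 0
    filter_upwards [h1.eventually hWsol] with p hp
    simpa [hF] using hp
  · -- the perturbation step
    have hnear : ∀ᶠ p in 𝓝 (0 : P), ‖p‖ < ε / 2 := by
      have : Metric.ball (0 : P) (ε / 2) ∈ 𝓝 (0 : P) := Metric.ball_mem_nhds _ (by linarith)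
      filter_upwards [this] with p hp
      simpa using hp
    filter_upwards [hnear] with p hp ρ hρ hρr Δ hΔ hΔlip
    -- points `(p, d)` with `|d| ≤ ρ` are in the good ball
    have hin : ∀ d : ℂ, ‖d‖ ≤ ρ → ((p, d) : P × ℂ) ∈ s ∩ {x | F (x, W x) = 0} := by
      intro d hd
      apply hball
      rw [Metric.mem_ball, show u.1 = (0 : P × ℂ) from rfl, dist_zero_right, Prod.norm_def]
      exact max_lt (by linarith) (by linarith)
    have hsol : ∀ d : ℂ, ‖d‖ ≤ ρ → f (p, W (p, d)) = d := by
      intro d hd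
      have := (hin d hd).2
      simp only [Set.mem_setOf_eq, hF] at this
      exact sub_eq_zero.1 this
    have hWdist : ∀ d d' : ℂ, ‖d‖ ≤ ρ → ‖d'‖ ≤ ρ → ‖W (p, d) - W (p, d')‖ ≤ K * ‖d - d'‖ := by
      intro d d' hd hd'
      have h := hWlip.dist_le_mul _ (hin d hd).1 _ (hin d' hd').1
      rw [dist_eq_norm, dist_eq_norm] at h
      have hpd : ‖((p, d) : P × ℂ) - (p, d')‖ = ‖d - d'‖ := by
        rw [Prod.mk_sub_mk, sub_self, Prod.norm_def]
        simp
      rwa [hpd] at h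
    have hWball : ∀ d : ℂ, ‖d‖ ≤ ρ → W (p, d) ∈ closedBall (W (p, 0)) (C * ρ) := by
      intro d hd
      rw [Metric.mem_closedBall, dist_eq_norm]
      have h := hWdist d 0 hd (by simp [hρ.le])
      rw [sub_zero] at h
      calc ‖W (p, d) - W (p, 0)‖ ≤ K * ‖d‖ := h
        _ ≤ C * ρ := mul_le_mul hKC hd (norm_nonneg _) hCpos.le
    -- the contraction `Φ d = -Δ (W (p, d))` on the closed ball `|d| ≤ ρ`
    set D : Set ℂ := closedBall (0 : ℂ) ρ with hD
    have hmemD : ∀ d : ℂ, d ∈ D ↔ ‖d‖ ≤ ρ := fun d => by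
      rw [hD, Metric.mem_closedBall, dist_zero_right]
    set Φ : ℂ → ℂ := fun d => -Δ (W (p, d)) with hΦ
    have hmaps : MapsTo Φ D D := by
      intro d hd
      rw [hmemD] at hd ⊢
      rw [hΦ, norm_neg]
      exact hΔ _ (hWball d hd)
    have hlipΦ : LipschitzOnWith (1 / 2 : NNReal) Φ D := by
      refine LipschitzOnWith.of_dist_le_mul fun d hd d' hd' => ?_
      rw [hmemD] at hd hd'
      rw [dist_eq_norm, dist_eq_norm, hΦ]
      simp only [neg_sub_neg]
      calc ‖Δ (W (p, d')) - Δ (W (p, d))‖ ≤ 1 / (2 * C) * ‖W (p, d') - W (p, d)‖ :=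
            hΔlip _ (hWball d' hd') _ (hWball d hd)
        _ ≤ 1 / (2 * C) * (K * ‖d' - d‖) :=
            mul_le_mul_of_nonneg_left (hWdist d' d hd' hd) (by positivity)
        _ ≤ ((1 / 2 : NNReal) : ℝ) * ‖d - d'‖ := by
            rw [norm_sub_rev d' d]
            have hKC' : K * ‖d - d'‖ ≤ C * ‖d - d'‖ :=
              mul_le_mul_of_nonneg_right hKC (norm_nonneg _)
            have : 1 / (2 * C) * (C * ‖d - d'‖) = 1 / 2 * ‖d - d'‖ := by field_simp
            push_cast
            calc 1 / (2 * C) * (K * ‖d - d'‖) ≤ 1 / (2 * C) * (C * ‖d - d'‖) :=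
                  mul_le_mul_of_nonneg_left hKC' (by positivity)
              _ = 1 / 2 * ‖d - d'‖ := this
    have hcontr : ContractingWith (1 / 2 : NNReal) (hmaps.restrict Φ D D) :=
      ⟨by norm_num, hlipΦ.mapsToRestrict hmaps⟩
    obtain ⟨dstar, hdD, hfix, -⟩ := hcontr.exists_fixedPoint' (isClosed_closedBall.isComplete) hmaps
      (x := 0) ((hmemD 0).2 (by simp [hρ.le])) (edist_ne_top _ _)
    rw [hmemD] at hdD
    refine ⟨W (p, dstar), hWball dstar hdD, ?_⟩
    have h1 : f (p, W (p, dstar)) = dstar := hsol dstar hdD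
    have h2 : dstar = -Δ (W (p, dstar)) := hfix.symm
    linear_combination h1 + h2

end Perturbed

end Summit.Schanuel.Schanuel.Theorems

end
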